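import Summits.QuantumFields.YangMills.Theorems.UnitScaleTiltProp7PosOfGaugeFixed
import Summits.QuantumFields.YangMills.Theorems.UnitScaleTiltProp7CoerciveSlotsOfInverseBound
import HarnessLib

/-!
# Route `UnitScaleTilt`, crux «MinimiserStabilityRegPr» (stmt-QuantumFields-19200, stub EX), node N06(d = 3) — **POSITIVITY AND COERCIVITY OF `Δ_a(U₀)` ARE MONOTONE IN THE GAUGE
# PROJECTOR: ANY ORTHOGONAL PROJECTION `R′` WITH `ran R′ ⊆ Δ^η_{U₀} N_S(U₀)` — e.g. PRINT'S `R(U₀)` = the projection onto `Δ^η_{U₀} N(Q′)` for ANY averaging `Q′` of the gauge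
# PARAMETERS that intertwines, `Q_k(U₀)(D_{U₀}λ) = D′(Q′λ)` ([Balaban1985BackgroundPropagators] (3.114)–(3.115)) — GIVES A SMALLER FORM: `re⟨x, (Δx + DR′D* + Q*aQ)x⟩ ≤ re⟨x, Δ_a(U₀)x⟩`.
# Hence the EX rows `hPosΔ`∕`hPosπ`∕`hPos₁` at the INTRINSIC letters (`R_S`, brick L0c) FOLLOW from their print-letter twins (Thm 3.11 with print's `R`), and so does every coercivity row**

Cell `ym3-torus` (HUMAN RULING D-0037; rung R3 — NOT d = 4, NOT Clay; YM gap NOT proved).  Fleet lead seat `ym-ust-19200-p1` (gen 21); CARD-19200-V3-g21 v2 §3 + NUMERICS-19200-RCORE-INTRINSIC-g21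
(kit j333714∕j333715∕j333721∕j333716∕j333719: with a gauge-COVARIANT averaging the intrinsic and print coercivity constants COINCIDE and are uniform in twist and curvature; a NON-covariant averaging
makes `rank(Q∘D)` jump and R-CORE collapse like ρ² — the property that matters is exactly the intertwining hypothesis `hint` of §4 below).  THEOREMS ONLY (0 `def`, 0 `sorry`);
`--supports stmt-QuantumFields-19200 --as helper`; count-neutral.  Nothing of [B9] §3 is asserted; this is linear algebra over bricks L0a∕L0c∕L0d and ✓`Prop7PosOfGaugeFixed`.

THE PRINT.  [B9] p. 394 (3.21): *«R the orthogonal projection onto Δ^η_U N(Q′)»*, p. 418 (3.115): *«the averages QA are invariant with respect to gauge transformations λ ∈ N(Q′)»* — i.e. `N(Q′) ⊆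
ker(Q∘D_U) = N_S(U)`: the tree's intrinsic residual algebra CONTAINS print's, so `R_S ≥ R` as projections and `‖R_S D*x‖ ≥ ‖R D*x‖`.  The (C2′) HONESTY CLAUSE of ✓`Prop7SectET3DeltaPiT3PInv`
(«finite-rank correction relative to print») is thereby made QUANTITATIVE for the positivity rows: the intrinsic rows are WEAKER than (implied by) print's.

WHAT IS PROVED (member `F n K`, `h : n ≤ K`, `c₀ cB > 0`, `a`, background `U₀`, Hessian slot `Δx`; a projector `Rr` on the site space with `Rr` symmetric, idempotent, `ran Rr ⊆ (N_S U₀).map Δ^η_{U₀}`;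
ns `…Theorems.Prop7PosMonotoneInProjector`).
* §1 `RS_apply_eq_self_of_mem_map`, ★ `norm_le_norm_RS_of_range_le` (`‖Rr u‖ ≤ ‖R_S(U₀) u‖`), `eq_zero_of_RS_eq_zero` (`R_S u = 0 ⇒ Rr u = 0`).
* §2 ★★ `re_inner_laplaceAK_proj_le` — `re⟨x, laplaceAK (Δx U₀) D Rr D* Q_k Q_k† a x⟩ ≤ re⟨x, laplaceA … Δx U₀ x⟩` (✓`re_inner_laplaceA`, ✓`Prop7CoerciveSlotsOfInverseBound.re_inner_laplaceAK_eq`);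
  ★★★ `pos_laplaceA_of_pos_proj`, ★★★ `coercive_laplaceA_of_coercive_proj`, ★★ `almostPos_laplaceA_of_almostPos_proj` — positivity ∕ `γ`-coercivity ∕ almost-positivity transfer from the
  `Rr`-operator to `Δ_a(U₀)` at ANY slot (`hPosΔ`'s slot `DeltaEtaSlot + TJSlotP` included).
* §3 the sandwiched slots: ★ `gaugeFixed_of_gaugeFixed_proj` (the slice `{R_S D*A = 0}` lies inside `{Rr D*A = 0}`), ★★★ `pos_laplaceA_DeltaOneP_of_gaugeFixed_proj` — positivity of
  `Δ^η + T_J + aQ_k†Q_k` on the LARGER slice `{Rr D* A = 0}` gives `hPosπ`∕`hPos₁`'s conclusion (over ✓`Prop7PosOfGaugeFixed.pos_laplaceA_DeltaOneP_of_gaugeFixed`).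
* §4 the natural instances: ★★ `projR_range_le_of_ker_le` — for ANY linear `Q″` on the gauge parameters with `ker Q″ ≤ N_S(U₀)`, `Rr := projR (Δ^η_{U₀}) Q″` (lit ✓`B11Eq103H1Complex.projR` = the
  orthogonal projection onto `Δ^η_{U₀} ker Q″`, print's (3.21) shape) satisfies the three hypotheses; ★★ `ker_le_NS_of_intertwining` — `ker Q″ ≤ N_S(U₀)` from the intertwining
  `Q(U₀)(D_{U₀}λ) = D′(Q″λ)` ((3.114)–(3.115); tree: ✓`Prop7SymAvgTwSGaugeDir.QTwS_gaugeDir_of_avgSeq`, ✓`Prop7QSymGaugeCovariance.QSym_gaugeDir`); ★★★ `pos_laplaceA_of_pos_projR` ∕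
  ★★★ `coercive_laplaceA_of_coercive_projR` — the headline: Thm 3.11 ∕ R-CORE proved with print's projector (any intertwining `Q″`) IMPLIES the intrinsic-letter rows.
HONEST SCOPE.  Linear algebra; no estimate; none of the 13 rows, `hThm2S`, EX or the crux is proved; nothing continuum ∕ OS ∕ mass-gap ∕ Clay.

References: T. Bałaban, CMP **99** (1985) 389–434 [Balaban1985BackgroundPropagators] ((3.19)–(3.26) pp.393–395, (3.114)–(3.115) p.418, Thm 3.11 p.416); CMP **102** (1985) 277–309
[Balaban1985Variational] ((110) p.294).
-/

set_option autoImplicit false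

noncomputable section

open scoped InnerProductSpace ComplexConjugate Matrix.Norms.L2Operator

namespace Summit.QuantumFields.YangMills.Theorems.Prop7PosMonotoneInProjector

open Literature.MathematicalPhysics.QuantumFieldTheory.Balaban1983to89
open Literature.MathematicalPhysics.QuantumFieldTheory.Balaban1983to89.T3ContinuumYM3Torus
open T3SectALandauChart (eta)
open B9Eq311L2Pairing (WL2)
open B11Eq103H1Complex (SiteL2K BondL2K laplaceAK projR projR_isSymmetric exists_ker_projR_eq projR_projR)
open Summit.QuantumFields.YangMills.Theorems.Prop7SectET3Transport (periodsT3)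
open Summit.QuantumFields.YangMills.Theorems.Prop7SectET3HilbertLetters (W₂ QL2 DL2 DstarL2 covLapSite adjoint_DL2)
open Summit.QuantumFields.YangMills.Theorems.Prop7SectET3GaugeProjector (QDS NS RS mem_NS_iff RS_apply_covLapSite_of_mem RS_RS RS_isSymmetric)
open Summit.QuantumFields.YangMills.Theorems.Prop7SectET3WilsonHessian (DeltaEta)
open Summit.QuantumFields.YangMills.Theorems.Prop7SectET3CurvedPropagators (Qk laplaceA)
open Summit.QuantumFields.YangMills.Theorems.Prop7SectET3DeltaOnePInv (DeltaOneP)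
open Summit.QuantumFields.YangMills.Theorems.Prop7LaplaceAFlatCoercive (re_inner_laplaceA)
open Summit.QuantumFields.YangMills.Theorems.Prop7CoerciveSlotsOfInverseBound (re_inner_proj_self re_inner_laplaceAK_eq)
open Summit.QuantumFields.YangMills.Theorems.Prop7PosOfGaugeFixed (pos_laplaceA_DeltaOneP_of_gaugeFixed)

variable {F : T3Family} {n K : ℕ} {h : n ≤ K} {c₀ cB a : ℝ} [Fact (0 < c₀)] [Fact (0 < cB)]

/-! ## §1 A projector whose range lies in `Δ^η_{U₀} N_S(U₀)` is dominated by `R_S(U₀)` -/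

omit [Fact (0 < cB)] in
/-- `R_S(U₀)` fixes every element of `Δ^η_{U₀} N_S(U₀)` (its range). [cite: Balaban1985BackgroundPropagators, (3.21)–(3.22) p.394] -/
theorem RS_apply_eq_self_of_mem_map (U₀ : GaugeField (F.P K) 0 (Matrix.specialUnitaryGroup (Fin 2) ℂ)) {v : SiteL2K ℂ 3 (periodsT3 F K) c₀ W₂}
    (hv : v ∈ (NS F n K h c₀ cB U₀).map (covLapSite F n K c₀ U₀)) : RS F n K h c₀ cB U₀ v = v := by
  obtain ⟨l, hl, rfl⟩ := Submodule.mem_map.1 hv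
  exact RS_apply_covLapSite_of_mem U₀ hl

omit [Fact (0 < cB)] in
/-- ★ **A SMALLER RESIDUAL ALGEBRA GIVES A SMALLER PENALTY**: if `Rr` is a symmetric idempotent with `ran Rr ⊆ Δ^η_{U₀} N_S(U₀)` (print's `R` onto `Δ^η_U N(Q′)`, `N(Q′) ⊆ N_S`), then
`‖Rr u‖ ≤ ‖R_S(U₀) u‖` for every `u` (`‖Rr u‖² = re⟨u, Rr u⟩ = re⟨R_S u, Rr u⟩ ≤ ‖R_S u‖‖Rr u‖`). [cite: Balaban1985BackgroundPropagators, (3.21) p.394, (3.115) p.418] -/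
theorem norm_le_norm_RS_of_range_le (U₀ : GaugeField (F.P K) 0 (Matrix.specialUnitaryGroup (Fin 2) ℂ))
    (Rr : SiteL2K ℂ 3 (periodsT3 F K) c₀ W₂ →ₗ[ℂ] SiteL2K ℂ 3 (periodsT3 F K) c₀ W₂) (hsym : Rr.IsSymmetric) (hidem : ∀ u, Rr (Rr u) = Rr u)
    (hran : ∀ u, Rr u ∈ (NS F n K h c₀ cB U₀).map (covLapSite F n K c₀ U₀)) (u : SiteL2K ℂ 3 (periodsT3 F K) c₀ W₂) :
    ‖Rr u‖ ≤ ‖RS F n K h c₀ cB U₀ u‖ := by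
  have h1 : ‖Rr u‖ ^ 2 = RCLike.re ⟪u, Rr u⟫_ℂ := (re_inner_proj_self Rr hsym hidem u).symm
  have h2 : ⟪u, Rr u⟫_ℂ = ⟪RS F n K h c₀ cB U₀ u, Rr u⟫_ℂ := by
    conv_lhs => rw [← RS_apply_eq_self_of_mem_map U₀ (hran u)]
    exact (RS_isSymmetric U₀ u (Rr u)).symm
  have h3 : ‖Rr u‖ ^ 2 ≤ ‖RS F n K h c₀ cB U₀ u‖ * ‖Rr u‖ := by
    rw [h1, h2]
    exact (RCLike.re_le_norm _).trans (norm_inner_le_norm _ _)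
  by_cases h0 : ‖Rr u‖ = 0
  · rw [h0]; exact norm_nonneg _
  · have hpos : 0 < ‖Rr u‖ := lt_of_le_of_ne (norm_nonneg _) (Ne.symm h0)
    have h4 : ‖Rr u‖ * ‖Rr u‖ ≤ ‖RS F n K h c₀ cB U₀ u‖ * ‖Rr u‖ := by rw [← pow_two]; exact h3
    exact le_of_mul_le_mul_right h4 hpos

omit [Fact (0 < cB)] in
/-- On the intrinsic slice the smaller projector vanishes too: `R_S(U₀) u = 0 ⇒ Rr u = 0`. [cite: Balaban1985BackgroundPropagators, (3.21) p.394] -/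
theorem eq_zero_of_RS_eq_zero (U₀ : GaugeField (F.P K) 0 (Matrix.specialUnitaryGroup (Fin 2) ℂ))
    (Rr : SiteL2K ℂ 3 (periodsT3 F K) c₀ W₂ →ₗ[ℂ] SiteL2K ℂ 3 (periodsT3 F K) c₀ W₂) (hsym : Rr.IsSymmetric) (hidem : ∀ u, Rr (Rr u) = Rr u)
    (hran : ∀ u, Rr u ∈ (NS F n K h c₀ cB U₀).map (covLapSite F n K c₀ U₀)) {u : SiteL2K ℂ 3 (periodsT3 F K) c₀ W₂} (hu : RS F n K h c₀ cB U₀ u = 0) :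
    Rr u = 0 := by
  have h1 := norm_le_norm_RS_of_range_le U₀ Rr hsym hidem hran u
  rw [hu, norm_zero] at h1
  exact norm_eq_zero.1 (le_antisymm h1 (norm_nonneg _))

/-! ## §2 The form of `Δx + D Rr D* + Q*aQ` is dominated by the form of `Δ_a(U₀)`; positivity ∕ coercivity ∕ almost-positivity transfer -/

/-- ★★ **MONOTONICITY OF THE FORM IN THE PROJECTOR**: `re⟨x, (Δx(U₀) + D_{U₀} Rr D*_{U₀} + Q_k†aQ_k)x⟩ ≤ re⟨x, Δ_a(U₀)x⟩` for every `x` — the two forms differ by `‖Rr D*x‖² ≤ ‖R_S D*x‖²`.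
[cite: Balaban1985BackgroundPropagators, (3.26) p.395, (3.21) p.394] -/
theorem re_inner_laplaceAK_proj_le
    (Δx : GaugeField (F.P K) 0 (Matrix.specialUnitaryGroup (Fin 2) ℂ) → (BondL2K ℂ 3 (periodsT3 F K) c₀ W₂ →ₗ[ℂ] BondL2K ℂ 3 (periodsT3 F K) c₀ W₂))
    (U₀ : GaugeField (F.P K) 0 (Matrix.specialUnitaryGroup (Fin 2) ℂ))
    (Rr : SiteL2K ℂ 3 (periodsT3 F K) c₀ W₂ →ₗ[ℂ] SiteL2K ℂ 3 (periodsT3 F K) c₀ W₂) (hsym : Rr.IsSymmetric) (hidem : ∀ u, Rr (Rr u) = Rr u)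
    (hran : ∀ u, Rr u ∈ (NS F n K h c₀ cB U₀).map (covLapSite F n K c₀ U₀)) (x : BondL2K ℂ 3 (periodsT3 F K) c₀ W₂) :
    RCLike.re ⟪x, laplaceAK (Δx U₀) (DL2 F n K c₀ U₀) Rr (DstarL2 F n K c₀ U₀) (Qk F n K h c₀ cB U₀) (LinearMap.adjoint (Qk F n K h c₀ cB U₀)) ((a : ℝ) : ℂ) x⟫_ℂ
      ≤ RCLike.re ⟪x, laplaceA F n K h c₀ cB a Δx U₀ x⟫_ℂ := by
  rw [re_inner_laplaceA a Δx U₀ x, ← adjoint_DL2, re_inner_laplaceAK_eq (Δx U₀) (DL2 F n K c₀ U₀) Rr (Qk F n K h c₀ cB U₀) ((a : ℝ) : ℂ) hsym hidem x]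
  have ha : RCLike.re ((a : ℝ) : ℂ) = a := by simp [RCLike.re_to_complex]
  rw [ha, adjoint_DL2]
  have hmono := norm_le_norm_RS_of_range_le U₀ Rr hsym hidem hran (DstarL2 F n K c₀ U₀ x)
  have hsq : ‖Rr (DstarL2 F n K c₀ U₀ x)‖ ^ 2 ≤ ‖RS F n K h c₀ cB U₀ (DstarL2 F n K c₀ U₀ x)‖ ^ 2 := pow_le_pow_left₀ (norm_nonneg _) hmono 2
  linarith

/-- ★★★ **POSITIVITY TRANSFERS FROM THE SMALLER PROJECTOR** (any slot `Δx`): if `Δx(U₀) + D Rr D* + Q*aQ` is positive definite then so is `Δ_a(U₀)` (intrinsic `R_S`) — [B9] Thm 3.11 proved with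
print's `R` gives the EX row `hPosΔ` at the tree's letters. [cite: Balaban1985BackgroundPropagators, Thm 3.11 p.416, (3.26) p.395] -/
theorem pos_laplaceA_of_pos_proj
    (Δx : GaugeField (F.P K) 0 (Matrix.specialUnitaryGroup (Fin 2) ℂ) → (BondL2K ℂ 3 (periodsT3 F K) c₀ W₂ →ₗ[ℂ] BondL2K ℂ 3 (periodsT3 F K) c₀ W₂))
    (U₀ : GaugeField (F.P K) 0 (Matrix.specialUnitaryGroup (Fin 2) ℂ))
    (Rr : SiteL2K ℂ 3 (periodsT3 F K) c₀ W₂ →ₗ[ℂ] SiteL2K ℂ 3 (periodsT3 F K) c₀ W₂) (hsym : Rr.IsSymmetric) (hidem : ∀ u, Rr (Rr u) = Rr u)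
    (hran : ∀ u, Rr u ∈ (NS F n K h c₀ cB U₀).map (covLapSite F n K c₀ U₀))
    (hpos : ∀ x : BondL2K ℂ 3 (periodsT3 F K) c₀ W₂, x ≠ 0 →
      0 < RCLike.re ⟪x, laplaceAK (Δx U₀) (DL2 F n K c₀ U₀) Rr (DstarL2 F n K c₀ U₀) (Qk F n K h c₀ cB U₀) (LinearMap.adjoint (Qk F n K h c₀ cB U₀)) ((a : ℝ) : ℂ) x⟫_ℂ) :
    ∀ x : BondL2K ℂ 3 (periodsT3 F K) c₀ W₂, x ≠ 0 → 0 < RCLike.re ⟪x, laplaceA F n K h c₀ cB a Δx U₀ x⟫_ℂ :=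
  fun x hx => (hpos x hx).trans_le (re_inner_laplaceAK_proj_le Δx U₀ Rr hsym hidem hran x)

/-- ★★★ **COERCIVITY TRANSFERS WITH THE SAME CONSTANT** (the R-CORE ∕ (A′) coercivity row of ★★OWNER RULING g28-№13): `γ‖x‖² ≤ re⟨x, (Δx + DRrD* + Q*aQ)x⟩ ∀x` ⟹ `γ‖x‖² ≤ re⟨x, Δ_a(U₀)x⟩ ∀x`.
[cite: Balaban1985BackgroundPropagators, Thm 3.11 p.416, Thm 3.3 p.399, (3.26) p.395] -/
theorem coercive_laplaceA_of_coercive_proj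
    (Δx : GaugeField (F.P K) 0 (Matrix.specialUnitaryGroup (Fin 2) ℂ) → (BondL2K ℂ 3 (periodsT3 F K) c₀ W₂ →ₗ[ℂ] BondL2K ℂ 3 (periodsT3 F K) c₀ W₂))
    (U₀ : GaugeField (F.P K) 0 (Matrix.specialUnitaryGroup (Fin 2) ℂ))
    (Rr : SiteL2K ℂ 3 (periodsT3 F K) c₀ W₂ →ₗ[ℂ] SiteL2K ℂ 3 (periodsT3 F K) c₀ W₂) (hsym : Rr.IsSymmetric) (hidem : ∀ u, Rr (Rr u) = Rr u)
    (hran : ∀ u, Rr u ∈ (NS F n K h c₀ cB U₀).map (covLapSite F n K c₀ U₀)) {γ : ℝ}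
    (hco : ∀ x : BondL2K ℂ 3 (periodsT3 F K) c₀ W₂,
      γ * ‖x‖ ^ 2 ≤ RCLike.re ⟪x, laplaceAK (Δx U₀) (DL2 F n K c₀ U₀) Rr (DstarL2 F n K c₀ U₀) (Qk F n K h c₀ cB U₀) (LinearMap.adjoint (Qk F n K h c₀ cB U₀)) ((a : ℝ) : ℂ) x⟫_ℂ) :
    ∀ x : BondL2K ℂ 3 (periodsT3 F K) c₀ W₂, γ * ‖x‖ ^ 2 ≤ RCLike.re ⟪x, laplaceA F n K h c₀ cB a Δx U₀ x⟫_ℂ :=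
  fun x => (hco x).trans (re_inner_laplaceAK_proj_le Δx U₀ Rr hsym hidem hran x)

/-- ★★ **ALMOST-POSITIVITY TRANSFERS** (`−θ‖x‖² ≤ …`, the `hθ` currency of ✓`Prop7CoerciveOfInverseBound`). [cite: Balaban1985BackgroundPropagators, (3.10) p.392, (3.26) p.395] -/
theorem almostPos_laplaceA_of_almostPos_proj
    (Δx : GaugeField (F.P K) 0 (Matrix.specialUnitaryGroup (Fin 2) ℂ) → (BondL2K ℂ 3 (periodsT3 F K) c₀ W₂ →ₗ[ℂ] BondL2K ℂ 3 (periodsT3 F K) c₀ W₂))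
    (U₀ : GaugeField (F.P K) 0 (Matrix.specialUnitaryGroup (Fin 2) ℂ))
    (Rr : SiteL2K ℂ 3 (periodsT3 F K) c₀ W₂ →ₗ[ℂ] SiteL2K ℂ 3 (periodsT3 F K) c₀ W₂) (hsym : Rr.IsSymmetric) (hidem : ∀ u, Rr (Rr u) = Rr u)
    (hran : ∀ u, Rr u ∈ (NS F n K h c₀ cB U₀).map (covLapSite F n K c₀ U₀)) {θ : ℝ}
    (hθ : ∀ x : BondL2K ℂ 3 (periodsT3 F K) c₀ W₂,
      -(θ * ‖x‖ ^ 2) ≤ RCLike.re ⟪x, laplaceAK (Δx U₀) (DL2 F n K c₀ U₀) Rr (DstarL2 F n K c₀ U₀) (Qk F n K h c₀ cB U₀) (LinearMap.adjoint (Qk F n K h c₀ cB U₀)) ((a : ℝ) : ℂ) x⟫_ℂ) :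
    ∀ x : BondL2K ℂ 3 (periodsT3 F K) c₀ W₂, -(θ * ‖x‖ ^ 2) ≤ RCLike.re ⟪x, laplaceA F n K h c₀ cB a Δx U₀ x⟫_ℂ :=
  fun x => (hθ x).trans (re_inner_laplaceAK_proj_le Δx U₀ Rr hsym hidem hran x)

/-! ## §3 The sandwiched slots: the intrinsic slice lies inside the `Rr`-slice -/

omit [Fact (0 < cB)] in
/-- ★ **THE INTRINSIC SLICE IS THE SMALLER ONE**: `R_S(U₀) D* A = 0 ⇒ Rr D* A = 0`. [cite: Balaban1985BackgroundPropagators, (3.118)–(3.119) p.419] -/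
theorem gaugeFixed_of_gaugeFixed_proj (U₀ : GaugeField (F.P K) 0 (Matrix.specialUnitaryGroup (Fin 2) ℂ))
    (Rr : SiteL2K ℂ 3 (periodsT3 F K) c₀ W₂ →ₗ[ℂ] SiteL2K ℂ 3 (periodsT3 F K) c₀ W₂) (hsym : Rr.IsSymmetric) (hidem : ∀ u, Rr (Rr u) = Rr u)
    (hran : ∀ u, Rr u ∈ (NS F n K h c₀ cB U₀).map (covLapSite F n K c₀ U₀)) {A : BondL2K ℂ 3 (periodsT3 F K) c₀ W₂}
    (hA : RS F n K h c₀ cB U₀ (DstarL2 F n K c₀ U₀ A) = 0) : Rr (DstarL2 F n K c₀ U₀ A) = 0 :=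
  eq_zero_of_RS_eq_zero U₀ Rr hsym hidem hran hA

/-- ★★★ **`hPosπ`∕`hPos₁` FROM POSITIVITY ON THE `Rr`-SLICE**: if `Δ^η(U₀) + T_J(U₀) + a·Q_k†Q_k` is positive on `{A : Rr D*_{U₀} A = 0}` (print's slice for print's `R`), then
`Δ_a(U₀) = Δ₁ᴾ(T_J) + DR_SD* + Q*aQ` is positive definite at the intrinsic letters (✓`Prop7PosOfGaugeFixed.pos_laplaceA_DeltaOneP_of_gaugeFixed` on the smaller intrinsic slice).
[cite: Balaban1985BackgroundPropagators, Thm 3.11 p.416, (3.118)–(3.122) pp.419–420, (3.128) p.421] -/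
theorem pos_laplaceA_DeltaOneP_of_gaugeFixed_proj (ha : 0 ≤ a)
    (TJ : GaugeField (F.P K) 0 (Matrix.specialUnitaryGroup (Fin 2) ℂ) → (BondL2K ℂ 3 (periodsT3 F K) c₀ W₂ →ₗ[ℂ] BondL2K ℂ 3 (periodsT3 F K) c₀ W₂))
    (U₀ : GaugeField (F.P K) 0 (Matrix.specialUnitaryGroup (Fin 2) ℂ))
    (Rr : SiteL2K ℂ 3 (periodsT3 F K) c₀ W₂ →ₗ[ℂ] SiteL2K ℂ 3 (periodsT3 F K) c₀ W₂) (hsym : Rr.IsSymmetric) (hidem : ∀ u, Rr (Rr u) = Rr u)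
    (hran : ∀ u, Rr u ∈ (NS F n K h c₀ cB U₀).map (covLapSite F n K c₀ U₀))
    (hgf : ∀ A : BondL2K ℂ 3 (periodsT3 F K) c₀ W₂, A ≠ 0 → Rr (DstarL2 F n K c₀ U₀ A) = 0 →
      0 < RCLike.re ⟪A, DeltaEta F n K c₀ U₀ A + TJ U₀ A⟫_ℂ + a * ‖Qk F n K h c₀ cB U₀ A‖ ^ 2) :
    ∀ x : BondL2K ℂ 3 (periodsT3 F K) c₀ W₂, x ≠ 0 →
      0 < RCLike.re ⟪x, laplaceA F n K h c₀ cB a (DeltaOneP F n K h c₀ cB a TJ) U₀ x⟫_ℂ :=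
  pos_laplaceA_DeltaOneP_of_gaugeFixed ha TJ U₀ fun A hA hR => hgf A hA (gaugeFixed_of_gaugeFixed_proj U₀ Rr hsym hidem hran hR)

/-! ## §4 The natural instances: `Rr := projR Δ^η_{U₀} Q″` for any parameter averaging `Q″` with `ker Q″ ≤ N_S(U₀)`, e.g. any `Q″` that intertwines -/

omit [Fact (0 < cB)] in
/-- ★★ **PRINT'S PROJECTOR SHAPE SATISFIES THE HYPOTHESES**: for any ℂ-linear `Q″` on the gauge parameters with `ker Q″ ≤ N_S(U₀)`, the orthogonal projection `projR Δ^η_{U₀} Q″` onto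
`Δ^η_{U₀} ker Q″` ((3.21) with `N := ker Q″`) is symmetric, idempotent, and ranges in `Δ^η_{U₀} N_S(U₀)`. [cite: Balaban1985BackgroundPropagators, (3.21)–(3.22) p.394] -/
theorem projR_hyps_of_ker_le {F' : Type*} [AddCommGroup F'] [Module ℂ F'] (U₀ : GaugeField (F.P K) 0 (Matrix.specialUnitaryGroup (Fin 2) ℂ))
    (Q'' : SiteL2K ℂ 3 (periodsT3 F K) c₀ W₂ →ₗ[ℂ] F') (hker : LinearMap.ker Q'' ≤ NS F n K h c₀ cB U₀) :
    (projR (covLapSite F n K c₀ U₀) Q'').IsSymmetric ∧ (∀ u, projR (covLapSite F n K c₀ U₀) Q'' (projR (covLapSite F n K c₀ U₀) Q'' u) = projR (covLapSite F n K c₀ U₀) Q'' u) ∧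
      (∀ u, projR (covLapSite F n K c₀ U₀) Q'' u ∈ (NS F n K h c₀ cB U₀).map (covLapSite F n K c₀ U₀)) := by
  refine ⟨projR_isSymmetric _ _, projR_projR _ _, fun u => ?_⟩
  obtain ⟨l, hl, hu⟩ := exists_ker_projR_eq (covLapSite F n K c₀ U₀) Q'' u
  rw [hu]
  exact Submodule.mem_map_of_mem (hker (LinearMap.mem_ker.2 hl))

omit [Fact (0 < cB)] in
/-- ★★ **INTERTWINING ⟹ `ker Q″ ≤ N_S(U₀)`** — [B9] (3.114)–(3.115): if the averaging of record maps gauge directions to coarse gauge directions, `Q(U₀)(D_{U₀}λ) = D′(Q″λ)` for some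
linear `D′` (tree: ✓`Prop7SymAvgTwSGaugeDir.QTwS_gaugeDir_of_avgSeq`, ✓`Prop7QSymGaugeCovariance.QSym_gaugeDir` shapes), then `Q″λ = 0 ⇒ λ ∈ N_S(U₀)`. [cite: Balaban1985BackgroundPropagators, (3.114)–(3.115) p.418] -/
theorem ker_le_NS_of_intertwining {F' : Type*} [AddCommGroup F'] [Module ℂ F'] (U₀ : GaugeField (F.P K) 0 (Matrix.specialUnitaryGroup (Fin 2) ℂ))
    (Q'' : SiteL2K ℂ 3 (periodsT3 F K) c₀ W₂ →ₗ[ℂ] F') (D' : F' →ₗ[ℂ] WL2 ℂ (fun _ : PBond (F.P n) 0 => cB) W₂)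
    (hint : ∀ l : SiteL2K ℂ 3 (periodsT3 F K) c₀ W₂, QL2 F n K h c₀ cB U₀ (DL2 F n K c₀ U₀ l) = D' (Q'' l)) :
    LinearMap.ker Q'' ≤ NS F n K h c₀ cB U₀ := by
  intro l hl
  rw [mem_NS_iff, hint, LinearMap.mem_ker.1 hl, map_zero]

/-- ★★★ **THE HEADLINE — THM 3.11 WITH PRINT'S PROJECTOR IMPLIES THE INTRINSIC ROW**: for any parameter averaging `Q″` with `ker Q″ ≤ N_S(U₀)` and any slot `Δx`, positivity of
`Δx(U₀) + D (projR Δ^η Q″) D* + Q*aQ` (print's `Δ_a(U₀)` of (3.26) when `Q″` = print's `Q′`) implies positivity of the tree's `Δ_a(U₀)`. [cite: Balaban1985BackgroundPropagators, Thm 3.11 p.416, (3.21)–(3.26) pp.394–395] -/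
theorem pos_laplaceA_of_pos_projR {F' : Type*} [AddCommGroup F'] [Module ℂ F']
    (Δx : GaugeField (F.P K) 0 (Matrix.specialUnitaryGroup (Fin 2) ℂ) → (BondL2K ℂ 3 (periodsT3 F K) c₀ W₂ →ₗ[ℂ] BondL2K ℂ 3 (periodsT3 F K) c₀ W₂))
    (U₀ : GaugeField (F.P K) 0 (Matrix.specialUnitaryGroup (Fin 2) ℂ)) (Q'' : SiteL2K ℂ 3 (periodsT3 F K) c₀ W₂ →ₗ[ℂ] F') (hker : LinearMap.ker Q'' ≤ NS F n K h c₀ cB U₀)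
    (hpos : ∀ x : BondL2K ℂ 3 (periodsT3 F K) c₀ W₂, x ≠ 0 →
      0 < RCLike.re ⟪x, laplaceAK (Δx U₀) (DL2 F n K c₀ U₀) (projR (covLapSite F n K c₀ U₀) Q'') (DstarL2 F n K c₀ U₀) (Qk F n K h c₀ cB U₀)
        (LinearMap.adjoint (Qk F n K h c₀ cB U₀)) ((a : ℝ) : ℂ) x⟫_ℂ) :
    ∀ x : BondL2K ℂ 3 (periodsT3 F K) c₀ W₂, x ≠ 0 → 0 < RCLike.re ⟪x, laplaceA F n K h c₀ cB a Δx U₀ x⟫_ℂ :=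
  have hh := projR_hyps_of_ker_le (h := h) (cB := cB) U₀ Q'' hker
  pos_laplaceA_of_pos_proj Δx U₀ _ hh.1 hh.2.1 hh.2.2 hpos

/-- ★★★ **… AND THE COERCIVITY ROW WITH THE SAME CONSTANT.** [cite: Balaban1985BackgroundPropagators, Thm 3.11 p.416, Thm 3.3 p.399] -/
theorem coercive_laplaceA_of_coercive_projR {F' : Type*} [AddCommGroup F'] [Module ℂ F']
    (Δx : GaugeField (F.P K) 0 (Matrix.specialUnitaryGroup (Fin 2) ℂ) → (BondL2K ℂ 3 (periodsT3 F K) c₀ W₂ →ₗ[ℂ] BondL2K ℂ 3 (periodsT3 F K) c₀ W₂))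
    (U₀ : GaugeField (F.P K) 0 (Matrix.specialUnitaryGroup (Fin 2) ℂ)) (Q'' : SiteL2K ℂ 3 (periodsT3 F K) c₀ W₂ →ₗ[ℂ] F') (hker : LinearMap.ker Q'' ≤ NS F n K h c₀ cB U₀)
    {γ : ℝ} (hco : ∀ x : BondL2K ℂ 3 (periodsT3 F K) c₀ W₂,
      γ * ‖x‖ ^ 2 ≤ RCLike.re ⟪x, laplaceAK (Δx U₀) (DL2 F n K c₀ U₀) (projR (covLapSite F n K c₀ U₀) Q'') (DstarL2 F n K c₀ U₀) (Qk F n K h c₀ cB U₀)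
        (LinearMap.adjoint (Qk F n K h c₀ cB U₀)) ((a : ℝ) : ℂ) x⟫_ℂ) :
    ∀ x : BondL2K ℂ 3 (periodsT3 F K) c₀ W₂, γ * ‖x‖ ^ 2 ≤ RCLike.re ⟪x, laplaceA F n K h c₀ cB a Δx U₀ x⟫_ℂ :=
  have hh := projR_hyps_of_ker_le (h := h) (cB := cB) U₀ Q'' hker
  coercive_laplaceA_of_coercive_proj Δx U₀ _ hh.1 hh.2.1 hh.2.2 hco

/-- ★★★ **THE SANDWICHED ROWS FROM PRINT'S SLICE**: positivity of `Δ^η + T_J + aQ_k†Q_k` on print's slice `{(projR Δ^η Q″) D* A = 0}` (any `Q″` with `ker Q″ ≤ N_S(U₀)`) gives the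
`hPosπ`∕`hPos₁` conclusion at the intrinsic letters. [cite: Balaban1985BackgroundPropagators, Thm 3.11 p.416, (3.118)–(3.122) pp.419–420] -/
theorem pos_laplaceA_DeltaOneP_of_gaugeFixed_projR {F' : Type*} [AddCommGroup F'] [Module ℂ F'] (ha : 0 ≤ a)
    (TJ : GaugeField (F.P K) 0 (Matrix.specialUnitaryGroup (Fin 2) ℂ) → (BondL2K ℂ 3 (periodsT3 F K) c₀ W₂ →ₗ[ℂ] BondL2K ℂ 3 (periodsT3 F K) c₀ W₂))
    (U₀ : GaugeField (F.P K) 0 (Matrix.specialUnitaryGroup (Fin 2) ℂ)) (Q'' : SiteL2K ℂ 3 (periodsT3 F K) c₀ W₂ →ₗ[ℂ] F') (hker : LinearMap.ker Q'' ≤ NS F n K h c₀ cB U₀)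
    (hgf : ∀ A : BondL2K ℂ 3 (periodsT3 F K) c₀ W₂, A ≠ 0 → projR (covLapSite F n K c₀ U₀) Q'' (DstarL2 F n K c₀ U₀ A) = 0 →
      0 < RCLike.re ⟪A, DeltaEta F n K c₀ U₀ A + TJ U₀ A⟫_ℂ + a * ‖Qk F n K h c₀ cB U₀ A‖ ^ 2) :
    ∀ x : BondL2K ℂ 3 (periodsT3 F K) c₀ W₂, x ≠ 0 →
      0 < RCLike.re ⟪x, laplaceA F n K h c₀ cB a (DeltaOneP F n K h c₀ cB a TJ) U₀ x⟫_ℂ :=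
  have hh := projR_hyps_of_ker_le (h := h) (cB := cB) U₀ Q'' hker
  pos_laplaceA_DeltaOneP_of_gaugeFixed_proj ha TJ U₀ _ hh.1 hh.2.1 hh.2.2 hgf

end Summit.QuantumFields.YangMills.Theorems.Prop7PosMonotoneInProjector

end
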